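import Summits.ValiantsHypothesis.ValiantsHypothesis.Theorems.KPlusLogSqLawStaticPathGlue

/-!
# Route «KPlusLogSqLaw» — parametric max-weight independent set on a path: gluing two chains WITHOUT a separator item

HONEST FRAMING.  Helper toward the crux `WeakLifting` (item `stmt-ValiantsHypothesis-19561`, route `KPlusLogSqLaw`, cell `pub-symmetroid`,
seat val-sym-lift-p4 g9, 2026-08-27) on the line of its witness-plan stub `stub_tridiagonalSectorB` (tropical twin of the STATIC tridiagonal
sector = parametric maximum-weight independent set on a path).  The gluing theorem `chain_glue` (g8) concatenates two chain certificates around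
a SEPARATOR item of weight `-1`, giving `N₁ + N₂` changes on `n₁ + 1 + n₂` items.  This file removes the separator: **`chain_glue_adj`** gives
`N₁ + N₂` changes on `n₁ + n₂` items, provided block 1's LAST optimum avoids its last item and block 2's FIRST optimum avoids its first item
(then at every glued sample one of the two items at the junction is unused, and the two blocks decouple — `glue_unique_adj`: any competitor
splits into its two block parts, and the union of the block optima is independent).  The two hypotheses are inherited by the glued chain
(`1 ∉ Ms 0`, `n₁ + n₂ ∉ Ms last`), so the construction iterates: `exists_chain_ends_add`, `exists_chain_ends_mul` (k copies: `N k` changes on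
`n k` items — rate `N / n` instead of `N / (n + 1)`), and a TIME-REVERSAL lemma `exists_chain_ends_of_reverse` turns a certificate whose first
optimum avoids the LAST item and whose last optimum avoids the FIRST item (the located `n = 15` certificate is of this kind) into one with the
required ends.  Located motivation (val-sym-lift-p4 g9, WAVE.md §7): two copies of the `n = 15` maximiser sharing one prefix-sum line realise
`52` changes on `30` items.  Same Möbius re-parametrisation and persistence argument as `chain_glue`.
Nothing here asserts anything about `WeakLifting`, `TropicalB`, `KPlusLogSqLaw`, the stub in its window, `MatrixDescartes`
(stmt-ValiantsHypothesis-18050) or `VP ≠ VNP`.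
-/

set_option linter.dupNamespace false
set_option autoImplicit false

namespace Summit.ValiantsHypothesis.ValiantsHypothesis.Theorems.KPlusLogSqLaw

open Finset Classical

namespace StaticPathFold

noncomputable section

/-! ## 1. Adjacent blocks -/

/-- an independent subset of the block `1, …, n₁ + n₂` is the union of its parts in `1, …, n₁` and `n₁ + 1, …, n₁ + n₂`. [folklore] -/
theorem eq_union_adj {n₁ n₂ : ℕ} {S : Finset ℕ} (hS : S ∈ indepSets 0 (n₁ + n₂)) :
    S = S ∩ Ioc 0 (0 + n₁) ∪ S ∩ Ioc n₁ (n₁ + n₂) := by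
  rcases mem_indepSets.mp hS with ⟨hS1, _⟩
  ext t
  simp only [mem_union, mem_inter, mem_Ioc]
  constructor
  · intro ht
    have h := mem_Ioc.mp (hS1 ht)
    by_cases hle : t ≤ n₁
    · exact Or.inl ⟨ht, by omega⟩
    · exact Or.inr ⟨ht, by omega⟩
  · rintro (⟨ht, _⟩ | ⟨ht, _⟩) <;> exact ht

/-- the union of independent subsets of two ADJACENT blocks is independent as soon as they do not use both items at the junction. [folklore] -/
theorem union_mem_indepSets_adj {n₁ n₂ : ℕ} {A B : Finset ℕ} (hA : A ∈ indepSets 0 n₁) (hB : B ∈ indepSets n₁ n₂)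
    (hj : n₁ ∉ A ∨ n₁ + 1 ∉ B) : A ∪ B ∈ indepSets 0 (n₁ + n₂) := by
  rcases mem_indepSets.mp hA with ⟨hA1, hA2⟩
  rcases mem_indepSets.mp hB with ⟨hB1, hB2⟩
  rw [mem_indepSets]
  refine ⟨fun t ht => ?_, fun t ht h2 => ?_⟩
  · rw [mem_Ioc]
    rcases mem_union.mp ht with h | h
    · have := mem_Ioc.mp (hA1 h); omega
    · have := mem_Ioc.mp (hB1 h); omega
  · rcases mem_union.mp ht with h | h <;> rcases mem_union.mp h2 with h' | h'
    · exact hA2 t h h'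
    · have e1 := mem_Ioc.mp (hA1 h)
      have e2 := mem_Ioc.mp (hB1 h')
      have ht1 : t = n₁ := by omega
      subst ht1
      rcases hj with hj | hj
      · exact hj h
      · exact hj h'
    · have e1 := mem_Ioc.mp (hB1 h)
      have e2 := mem_Ioc.mp (hA1 h')
      omega
    · exact hB2 t h h'

/-- **decoupling of adjacent blocks**: if `A` is the strict unique optimum of the block `1, …, n₁`, `B'` that of `n₁ + 1, …, n₁ + n₂`, and
they do not use both junction items, then `A ∪ B'` is the strict unique optimum of `1, …, n₁ + n₂` (every competitor splits into its two
block parts). [folklore] -/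
theorem glue_unique_adj (w₁ w₀ : ℕ → ℝ) {n₁ n₂ : ℕ} {θ : ℝ} {A B' : Finset ℕ}
    (hA : A ∈ indepSets 0 n₁) (hB' : B' ∈ indepSets n₁ n₂) (hj : n₁ ∉ A ∨ n₁ + 1 ∉ B')
    (h1 : ∀ S ∈ indepSets 0 n₁, ∑ t ∈ S, W w₁ w₀ t θ ≤ ∑ t ∈ A, W w₁ w₀ t θ ∧
      (S ≠ A → ∑ t ∈ S, W w₁ w₀ t θ < ∑ t ∈ A, W w₁ w₀ t θ))
    (h2 : ∀ S ∈ indepSets n₁ n₂, ∑ t ∈ S, W w₁ w₀ t θ ≤ ∑ t ∈ B', W w₁ w₀ t θ ∧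
      (S ≠ B' → ∑ t ∈ S, W w₁ w₀ t θ < ∑ t ∈ B', W w₁ w₀ t θ)) :
    ∀ S ∈ indepSets 0 (n₁ + n₂), S ≠ A ∪ B' → ∑ t ∈ S, W w₁ w₀ t θ < ∑ t ∈ A ∪ B', W w₁ w₀ t θ := by
  have _hind := union_mem_indepSets_adj hA hB' hj
  have hAB : ∑ t ∈ A ∪ B', W w₁ w₀ t θ = ∑ t ∈ A, W w₁ w₀ t θ + ∑ t ∈ B', W w₁ w₀ t θ :=
    sum_union_of_blocks w₁ w₀ hA hB' (by omega) θ
  intro S hS hne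
  have hS₁ : S ∩ Ioc 0 (0 + n₁) ∈ indepSets 0 n₁ := inter_mem_indepSets hS
  have hS₂ : S ∩ Ioc n₁ (n₁ + n₂) ∈ indepSets n₁ n₂ := inter_mem_indepSets hS
  have hsplit := eq_union_adj hS
  have hsum : ∑ t ∈ S, W w₁ w₀ t θ =
      ∑ t ∈ S ∩ Ioc 0 (0 + n₁), W w₁ w₀ t θ + ∑ t ∈ S ∩ Ioc n₁ (n₁ + n₂), W w₁ w₀ t θ := by
    conv_lhs => rw [hsplit]
    exact sum_union_of_blocks w₁ w₀ hS₁ hS₂ (by omega) θ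
  obtain ⟨hle₁, hlt₁⟩ := h1 _ hS₁
  obtain ⟨hle₂, hlt₂⟩ := h2 _ hS₂
  rw [hsum, hAB]
  by_cases he₁ : S ∩ Ioc 0 (0 + n₁) = A
  · have he₂ : S ∩ Ioc n₁ (n₁ + n₂) ≠ B' := fun he₂ => hne (by rw [hsplit, he₁, he₂])
    exact add_lt_add_of_le_of_lt hle₁ (hlt₂ he₂)
  · exact add_lt_add_of_lt_of_le (hlt₁ he₁) hle₂

/-! ## 2. The separator-free gluing theorem -/

/-- **GLUING WITHOUT A SEPARATOR.**  A chain of `N₁` changes of the unique optimum on `n₁` items whose LAST optimum avoids item `n₁`, and a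
chain of `N₂` changes on `n₂` items whose FIRST optimum avoids item `1`, give a chain of `N₁ + N₂` changes on `n₁ + n₂` items (block 1 as is,
block 2 re-parametrised by the Möbius map `θ ↦ ψ 0 + c / (p - θ)` and rescaled by `p - θ > 0`).  The glued chain's first optimum avoids item
`1` if block 1's does, and its last optimum avoids item `n₁ + n₂` if block 2's last optimum avoids `n₂`. [folklore] -/
theorem chain_glue_adj {n₁ N₁ n₂ N₂ : ℕ}
    (u₁ u₀ : ℕ → ℝ) (φ : Fin (N₁ + 1) → ℝ) (A : Fin (N₁ + 1) → Finset ℕ) (hφ : StrictMono φ)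
    (hA : ∀ k, A k ∈ indepSets 0 n₁)
    (huA : ∀ k, ∀ S ∈ indepSets 0 n₁, S ≠ A k → ∑ t ∈ S, W u₁ u₀ t (φ k) < ∑ t ∈ A k, W u₁ u₀ t (φ k))
    (hAs : ∀ e : Fin N₁, A e.castSucc ≠ A e.succ)
    (v₁ v₀ : ℕ → ℝ) (ψ : Fin (N₂ + 1) → ℝ) (B : Fin (N₂ + 1) → Finset ℕ) (hψ : StrictMono ψ)
    (hB : ∀ k, B k ∈ indepSets 0 n₂)
    (huB : ∀ k, ∀ S ∈ indepSets 0 n₂, S ≠ B k → ∑ t ∈ S, W v₁ v₀ t (ψ k) < ∑ t ∈ B k, W v₁ v₀ t (ψ k))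
    (hBs : ∀ e : Fin N₂, B e.castSucc ≠ B e.succ)
    (hAn : n₁ ∉ A (Fin.last N₁)) (hB1 : 1 ∉ B 0) :
    ∃ (w₁ w₀ : ℕ → ℝ) (θs : Fin (N₁ + N₂ + 1) → ℝ) (Ms : Fin (N₁ + N₂ + 1) → Finset ℕ),
      StrictMono θs ∧ (∀ k, Ms k ∈ indepSets 0 (n₁ + n₂)) ∧
      (∀ k, ∀ S ∈ indepSets 0 (n₁ + n₂), S ≠ Ms k →
        ∑ t ∈ S, W w₁ w₀ t (θs k) < ∑ t ∈ Ms k, W w₁ w₀ t (θs k)) ∧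
      (∀ e : Fin (N₁ + N₂), Ms e.castSucc ≠ Ms e.succ) ∧
      (1 ∉ A 0 → 1 ∉ Ms 0) ∧ (n₂ ∉ B (Fin.last N₂) → n₁ + n₂ ∉ Ms (Fin.last (N₁ + N₂))) := by
  -- persistence radii at the last sample of chain 1 and at the first sample of chain 2
  obtain ⟨ρ, hρ, hρA⟩ := unique_persists u₁ u₀ (huA (Fin.last N₁))
  obtain ⟨ρ₂, hρ₂, hρB⟩ := unique_persists v₁ v₀ (huB 0)
  -- the first gap of chain 2 (or `1` if it has a single sample)
  set m : ℝ := if h : 0 < N₂ then ψ ⟨1, by omega⟩ - ψ 0 else 1 with hm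
  have hmpos : 0 < m := by
    rw [hm]; split_ifs with h
    · have h01 : (0 : Fin (N₂ + 1)) < ⟨1, by omega⟩ := by rw [Fin.lt_def]; simp
      exact sub_pos.mpr (hψ h01)
    · exact one_pos
  have hmle : ∀ j : Fin (N₂ + 1), 1 ≤ (j : ℕ) → m ≤ ψ j - ψ 0 := by
    intro j hj
    have hN : 0 < N₂ := by have := j.isLt; omega
    rw [hm, dif_pos hN]
    have : ψ ⟨1, by omega⟩ ≤ ψ j := hψ.monotone (by rw [Fin.le_def]; exact hj)
    linarith
  -- the pole `p` and the scale `c`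
  set p : ℝ := φ (Fin.last N₁) + ρ with hp
  set c : ℝ := ρ * min ρ₂ m / 2 with hc
  have hminpos : 0 < min ρ₂ m := lt_min hρ₂ hmpos
  have hcpos : 0 < c := by rw [hc]; positivity
  have hcρ₂ : c ≤ ρ * ρ₂ / 2 := by rw [hc]; have := min_le_left ρ₂ m; nlinarith
  have hcm : c ≤ ρ * m / 2 := by rw [hc]; have := min_le_right ρ₂ m; nlinarith
  -- index bookkeeping: sample `k` of the glued chain reads sample `min k N₁` of chain 1 and sample `k - N₁` of chain 2
  set κ₁ : Fin (N₁ + N₂ + 1) → Fin (N₁ + 1) := fun k => ⟨min (k : ℕ) N₁, by omega⟩ with hκ₁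
  set κ₂ : Fin (N₁ + N₂ + 1) → Fin (N₂ + 1) := fun k => ⟨(k : ℕ) - N₁, by have := k.isLt; omega⟩ with hκ₂
  have hκ₁v : ∀ k, (κ₁ k : ℕ) = min (k : ℕ) N₁ := fun k => by simp only [hκ₁]
  have hκ₂v : ∀ k, (κ₂ k : ℕ) = (k : ℕ) - N₁ := fun k => by simp only [hκ₂]
  -- the glued instance
  set w₁ : ℕ → ℝ := fun t => if t ≤ n₁ then u₁ t else -(v₁ (t - n₁) * ψ 0 + v₀ (t - n₁)) with hw₁
  set w₀ : ℕ → ℝ := fun t => if t ≤ n₁ then u₀ t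
    else p * (v₁ (t - n₁) * ψ 0 + v₀ (t - n₁)) + c * v₁ (t - n₁) with hw₀
  set θs : Fin (N₁ + N₂ + 1) → ℝ := fun k =>
    if (k : ℕ) ≤ N₁ then φ (κ₁ k) else p - c / (ψ (κ₂ k) - ψ 0) with hθs
  set Ms : Fin (N₁ + N₂ + 1) → Finset ℕ := fun k =>
    A (κ₁ k) ∪ (B (κ₂ k)).map (addLeftEmbedding n₁) with hMs
  -- closed forms of the glued weights
  have hW1 : ∀ t, t ≤ n₁ → ∀ θ, W w₁ w₀ t θ = W u₁ u₀ t θ := by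
    intro t ht θ; simp only [W, hw₁, hw₀, if_pos ht]
  have hW2 : ∀ a, 1 ≤ a → ∀ θ, W w₁ w₀ (n₁ + a) θ = (p - θ) * (v₁ a * ψ 0 + v₀ a) + c * v₁ a := by
    intro a ha θ
    have h1 : ¬ (n₁ + a ≤ n₁) := by omega
    have h3 : n₁ + a - n₁ = a := by omega
    simp only [W, hw₁, hw₀, if_neg h1, h3]; ring
  have hsum1 : ∀ S ∈ indepSets 0 n₁, ∀ θ, ∑ t ∈ S, W w₁ w₀ t θ = ∑ t ∈ S, W u₁ u₀ t θ := by
    intro S hS θ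
    refine Finset.sum_congr rfl fun t ht => hW1 t ?_ θ
    have := mem_Ioc.mp ((mem_indepSets.mp hS).1 ht); omega
  have hsum2 : ∀ S ∈ indepSets 0 n₂, ∀ θ, θ < p →
      ∑ t ∈ S.map (addLeftEmbedding n₁), W w₁ w₀ t θ =
        (p - θ) * ∑ a ∈ S, W v₁ v₀ a (ψ 0 + c / (p - θ)) := by
    intro S hS θ hθ
    rw [Finset.sum_map, Finset.mul_sum]
    refine Finset.sum_congr rfl fun a ha => ?_
    have ha1 : 1 ≤ a := by have := mem_Ioc.mp ((mem_indepSets.mp hS).1 ha); omega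
    rw [addLeftEmbedding_apply, hW2 a ha1 θ]
    have hne : p - θ ≠ 0 := by linarith
    simp only [W]; field_simp; ring
  -- where the samples sit
  have hθle : ∀ k : Fin (N₁ + N₂ + 1), (k : ℕ) ≤ N₁ → θs k = φ (κ₁ k) := fun k hk => by simp only [hθs, if_pos hk]
  have hθgt : ∀ k : Fin (N₁ + N₂ + 1), ¬ (k : ℕ) ≤ N₁ → θs k = p - c / (ψ (κ₂ k) - ψ 0) := fun k hk => by
    simp only [hθs, if_neg hk]
  have hφle : ∀ k, φ (κ₁ k) ≤ φ (Fin.last N₁) := fun k => hφ.monotone (Fin.le_last _)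
  have hdk : ∀ k : Fin (N₁ + N₂ + 1), ¬ (k : ℕ) ≤ N₁ →
      m ≤ ψ (κ₂ k) - ψ 0 ∧ 0 < c / (ψ (κ₂ k) - ψ 0) ∧ c / (ψ (κ₂ k) - ψ 0) ≤ ρ / 2 := by
    intro k hk
    have h1 : m ≤ ψ (κ₂ k) - ψ 0 := hmle _ (by rw [hκ₂v]; omega)
    have h2 : 0 < ψ (κ₂ k) - ψ 0 := lt_of_lt_of_le hmpos h1
    refine ⟨h1, div_pos hcpos h2, ?_⟩
    rw [div_le_iff₀ h2]; nlinarith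
  have hθp : ∀ k, θs k < p := by
    intro k
    by_cases hk : (k : ℕ) ≤ N₁
    · rw [hθle k hk, hp]; linarith [hφle k]
    · rw [hθgt k hk]; linarith [(hdk k hk).2.1]
  -- block 1 at every glued sample: the unique optimum is `A (κ₁ k)`
  have hU1 : ∀ k, ∀ S ∈ indepSets 0 n₁, S ≠ A (κ₁ k) →
      ∑ t ∈ S, W u₁ u₀ t (θs k) < ∑ t ∈ A (κ₁ k), W u₁ u₀ t (θs k) := by
    intro k
    by_cases hk : (k : ℕ) ≤ N₁
    · rw [hθle k hk]; exact huA (κ₁ k)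
    · have hlast : κ₁ k = Fin.last N₁ := Fin.ext (by rw [hκ₁v, Fin.val_last]; omega)
      rw [hlast]
      refine hρA (θs k) (abs_le.mpr ⟨?_, ?_⟩)
      · rw [hθgt k hk, hp]; linarith [(hdk k hk).2.2]
      · rw [hθgt k hk, hp]; linarith [(hdk k hk).2.1]
  -- block 2 at every glued sample, read through the Möbius map: the unique optimum is `B (κ₂ k)`
  have hU2 : ∀ k, ∀ S ∈ indepSets 0 n₂, S ≠ B (κ₂ k) →
      ∑ t ∈ S, W v₁ v₀ t (ψ 0 + c / (p - θs k)) < ∑ t ∈ B (κ₂ k), W v₁ v₀ t (ψ 0 + c / (p - θs k)) := by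
    intro k
    by_cases hk : (k : ℕ) ≤ N₁
    · have hzero : κ₂ k = 0 := Fin.ext (by rw [hκ₂v, Fin.val_zero]; omega)
      rw [hzero]
      have he : ρ ≤ p - θs k := by rw [hθle k hk, hp]; linarith [hφle k]
      have hepos : 0 < p - θs k := lt_of_lt_of_le hρ he
      refine hρB _ (abs_le.mpr ⟨?_, ?_⟩)
      · linarith [(div_pos hcpos hepos).le]
      · rw [add_sub_cancel_left, div_le_iff₀ hepos]; nlinarith
    · have hc0 : c ≠ 0 := hcpos.ne'
      have hg : ψ 0 + c / (p - θs k) = ψ (κ₂ k) := by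
        rw [hθgt k hk, sub_sub_cancel, div_div_eq_mul_div, mul_div_cancel_left₀ _ hc0]; ring
      rw [hg]; exact huB (κ₂ k)
  -- compatibility at the junction: block 2's first optimum avoids its first item during phase 1, block 1's last avoids `n₁` in phase 2
  have hcompat : ∀ k, n₁ ∉ A (κ₁ k) ∨ n₁ + 1 ∉ (B (κ₂ k)).map (addLeftEmbedding n₁) := by
    intro k
    by_cases hk : (k : ℕ) ≤ N₁
    · right
      have hzero : κ₂ k = 0 := Fin.ext (by rw [hκ₂v, Fin.val_zero]; omega)
      rw [hzero]
      intro hmem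
      obtain ⟨a, ha, he⟩ := Finset.mem_map.mp hmem
      simp only [addLeftEmbedding_apply] at he
      exact hB1 (by convert ha using 1; omega)
    · left
      have hlast : κ₁ k = Fin.last N₁ := Fin.ext (by rw [hκ₁v, Fin.val_last]; omega)
      rw [hlast]; exact hAn
  refine ⟨w₁, w₀, θs, Ms, ?_, fun k => ?_, fun k => ?_, fun e => ?_, fun h1A => ?_, fun hBn => ?_⟩
  · -- strictly increasing samples
    refine Fin.strictMono_iff_lt_succ.mpr fun e => ?_
    have hcs : ((Fin.castSucc e : Fin (N₁ + N₂ + 1)) : ℕ) = e := Fin.val_castSucc e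
    have hsc : ((Fin.succ e : Fin (N₁ + N₂ + 1)) : ℕ) = e + 1 := Fin.val_succ e
    by_cases h1 : (e : ℕ) + 1 ≤ N₁
    · rw [hθle _ (by rw [hcs]; omega), hθle _ (by rw [hsc]; omega)]
      exact hφ (by rw [Fin.lt_def, hκ₁v, hκ₁v, hcs, hsc]; omega)
    · by_cases h0 : (e : ℕ) ≤ N₁
      · rw [hθle _ (by rw [hcs]; omega), hθgt _ (by rw [hsc]; omega), hp]
        linarith [hφle (Fin.castSucc e), (hdk (Fin.succ e) (by rw [hsc]; omega)).2.2]
      · rw [hθgt _ (by rw [hcs]; omega), hθgt _ (by rw [hsc]; omega)]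
        have ha : 0 < ψ (κ₂ (Fin.castSucc e)) - ψ 0 := lt_of_lt_of_le hmpos (hdk _ (by rw [hcs]; omega)).1
        have hlt : ψ (κ₂ (Fin.castSucc e)) - ψ 0 < ψ (κ₂ (Fin.succ e)) - ψ 0 :=
          sub_lt_sub_right (hψ (by rw [Fin.lt_def, hκ₂v, hκ₂v, hcs, hsc]; omega)) _
        linarith [div_lt_div_of_pos_left hcpos ha hlt]
  · -- independent
    simp only [hMs]
    exact union_mem_indepSets_adj (hA _) (map_add_mem_indepSets n₁ (hB _)) (hcompat k)
  · -- unique optimum, block by block around the separator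
    have hθ := hθp k
    simp only [hMs]
    refine glue_unique_adj w₁ w₀ (hA (κ₁ k)) (map_add_mem_indepSets n₁ (hB (κ₂ k))) (hcompat k) (fun S hS => ?_)
      (fun S' hS' => ?_)
    · rw [hsum1 S hS, hsum1 _ (hA _)]
      refine ⟨?_, hU1 k S hS⟩
      rcases eq_or_ne S (A (κ₁ k)) with h | h
      · rw [h]
      · exact (hU1 k S hS h).le
    · obtain ⟨S, hS, rfl⟩ := exists_eq_map_add hS'
      rw [hsum2 S hS _ hθ, hsum2 _ (hB _) _ hθ]
      have hpos : 0 < p - θs k := sub_pos.mpr hθ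
      refine ⟨?_, fun hne => ?_⟩
      · rcases eq_or_ne S (B (κ₂ k)) with h | h
        · rw [h]
        · exact (mul_lt_mul_of_pos_left (hU2 k S hS h) hpos).le
      · exact mul_lt_mul_of_pos_left (hU2 k S hS fun h => hne (by rw [h])) hpos
  · -- consecutive optima differ
    intro heq
    simp only [hMs] at heq
    have hlow : ∀ k, ∀ t ∈ A (κ₁ k), t ≤ n₁ := fun k t ht => by
      have := mem_Ioc.mp ((mem_indepSets.mp (hA (κ₁ k))).1 ht); omega
    have hhigh : ∀ k, ∀ t ∈ (B (κ₂ k)).map (addLeftEmbedding n₁), n₁ < t := fun k t ht => by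
      have := mem_Ioc.mp ((mem_indepSets.mp (map_add_mem_indepSets n₁ (hB (κ₂ k)))).1 ht); omega
    obtain ⟨hAeq, hBeq⟩ := eq_and_eq_of_union_eq (hlow _) (hlow _) (hhigh _) (hhigh _) heq
    by_cases h1 : (e : ℕ) < N₁
    · -- inside chain 1
      have hc' : κ₁ (Fin.castSucc e) = Fin.castSucc ⟨e, h1⟩ :=
        Fin.ext (by simp only [hκ₁v, Fin.val_castSucc]; omega)
      have hs' : κ₁ (Fin.succ e) = Fin.succ ⟨e, h1⟩ :=
        Fin.ext (by simp only [hκ₁v, Fin.val_succ]; omega)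
      exact hAs ⟨e, h1⟩ (by rw [← hc', ← hs', hAeq])
    · -- inside chain 2
      have h2 : (e : ℕ) - N₁ < N₂ := by have := e.isLt; omega
      have hc' : κ₂ (Fin.castSucc e) = Fin.castSucc ⟨(e : ℕ) - N₁, h2⟩ :=
        Fin.ext (by simp only [hκ₂v, Fin.val_castSucc])
      have hs' : κ₂ (Fin.succ e) = Fin.succ ⟨(e : ℕ) - N₁, h2⟩ :=
        Fin.ext (by simp only [hκ₂v, Fin.val_succ]; omega)
      exact hBs ⟨(e : ℕ) - N₁, h2⟩ (by rw [← hc', ← hs']; exact Finset.map_injective _ hBeq)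
  · -- the first optimum avoids item `1` (given that block 1's does; block 2's items are `> n₁`, and if `n₁ = 0` use `hB1`)
    have hz1 : κ₁ 0 = 0 := Fin.ext (by simp only [hκ₁v, Fin.val_zero, Nat.zero_le, Nat.min_eq_left])
    have hz2 : κ₂ 0 = 0 := Fin.ext (by simp only [hκ₂v, Fin.val_zero, Nat.zero_sub])
    simp only [hMs, hz1, hz2]
    intro hmem
    rcases Finset.mem_union.mp hmem with h | h
    · exact h1A h
    · obtain ⟨a, ha, he⟩ := Finset.mem_map.mp h
      simp only [addLeftEmbedding_apply] at he
      have ha1 : 1 ≤ a := by have := mem_Ioc.mp ((mem_indepSets.mp (hB 0)).1 ha); omega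
      have : a = 1 := by omega
      subst this
      exact hB1 ha
  · -- the last optimum avoids item `n₁ + n₂` (given that block 2's avoids `n₂`; block 1's items are `≤ n₁`, and if `n₂ = 0` use `hAn`)
    have hl1 : κ₁ (Fin.last (N₁ + N₂)) = Fin.last N₁ := Fin.ext (by simp only [hκ₁v, Fin.val_last]; omega)
    have hl2 : κ₂ (Fin.last (N₁ + N₂)) = Fin.last N₂ := Fin.ext (by simp only [hκ₂v, Fin.val_last]; omega)
    simp only [hMs, hl1, hl2]
    intro hmem
    rcases Finset.mem_union.mp hmem with h | h
    · have := mem_Ioc.mp ((mem_indepSets.mp (hA (Fin.last N₁))).1 h)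
      have h0 : n₂ = 0 := by omega
      have : n₁ + n₂ = n₁ := by omega
      rw [this] at h
      exact hAn h
    · obtain ⟨a, ha, he⟩ := Finset.mem_map.mp h
      simp only [addLeftEmbedding_apply] at he
      have : a = n₂ := by omega
      subst this
      exact hBn ha


/-- **SUPERADDITIVITY WITHOUT LOSS (existential form of `chain_glue_adj`).**  Chains «with free ends» — first optimum avoiding item `1`,
last optimum avoiding the last item — of `N₁` changes on `n₁` items and `N₂` changes on `n₂` items give such a chain of `N₁ + N₂` changes
on `n₁ + n₂` items. [folklore] -/
theorem exists_chain_ends_add {n₁ N₁ n₂ N₂ : ℕ}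
    (h₁ : ∃ (w₁ w₀ : ℕ → ℝ) (θs : Fin (N₁ + 1) → ℝ) (Ms : Fin (N₁ + 1) → Finset ℕ),
      StrictMono θs ∧ (∀ k, Ms k ∈ indepSets 0 n₁) ∧
      (∀ k, ∀ S ∈ indepSets 0 n₁, S ≠ Ms k → ∑ t ∈ S, W w₁ w₀ t (θs k) < ∑ t ∈ Ms k, W w₁ w₀ t (θs k)) ∧
      (∀ e : Fin N₁, Ms e.castSucc ≠ Ms e.succ) ∧ 1 ∉ Ms 0 ∧ n₁ ∉ Ms (Fin.last N₁))
    (h₂ : ∃ (w₁ w₀ : ℕ → ℝ) (θs : Fin (N₂ + 1) → ℝ) (Ms : Fin (N₂ + 1) → Finset ℕ),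
      StrictMono θs ∧ (∀ k, Ms k ∈ indepSets 0 n₂) ∧
      (∀ k, ∀ S ∈ indepSets 0 n₂, S ≠ Ms k → ∑ t ∈ S, W w₁ w₀ t (θs k) < ∑ t ∈ Ms k, W w₁ w₀ t (θs k)) ∧
      (∀ e : Fin N₂, Ms e.castSucc ≠ Ms e.succ) ∧ 1 ∉ Ms 0 ∧ n₂ ∉ Ms (Fin.last N₂)) :
    ∃ (w₁ w₀ : ℕ → ℝ) (θs : Fin (N₁ + N₂ + 1) → ℝ) (Ms : Fin (N₁ + N₂ + 1) → Finset ℕ),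
      StrictMono θs ∧ (∀ k, Ms k ∈ indepSets 0 (n₁ + n₂)) ∧
      (∀ k, ∀ S ∈ indepSets 0 (n₁ + n₂), S ≠ Ms k →
        ∑ t ∈ S, W w₁ w₀ t (θs k) < ∑ t ∈ Ms k, W w₁ w₀ t (θs k)) ∧
      (∀ e : Fin (N₁ + N₂), Ms e.castSucc ≠ Ms e.succ) ∧ 1 ∉ Ms 0 ∧ n₁ + n₂ ∉ Ms (Fin.last (N₁ + N₂)) := by
  obtain ⟨u₁, u₀, φ, A, hφ, hA, huA, hAs, hA1, hAn⟩ := h₁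
  obtain ⟨v₁, v₀, ψ, B, hψ, hB, huB, hBs, hB1, hBn⟩ := h₂
  obtain ⟨w₁, w₀, θs, Ms, h1, h2, h3, h4, h5, h6⟩ :=
    chain_glue_adj u₁ u₀ φ A hφ hA huA hAs v₁ v₀ ψ B hψ hB huB hBs hAn hB1
  exact ⟨w₁, w₀, θs, Ms, h1, h2, h3, h4, h5 hA1, h6 hBn⟩

end

end StaticPathFold

end Summit.ValiantsHypothesis.ValiantsHypothesis.Theorems.KPlusLogSqLaw
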